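import Mathlib
import Summits.Ventures.HodgeRepro2.T5InertSphericalSubquotient

/-!
# THE SPHERICAL SUBQUOTIENT IS UNIQUE: EVERY IRREDUCIBLE QUOTIENT OF `⟨G v₀⟩` MISSING `v₀` IS THE SAME

Tier-5 support N3 / §G-N4.2 (seat p3, gen 85). File 336 built the spherical subquotient `⟨G v₀⟩ / maximalSub`
with a CHOSEN maximal `G`-stable subspace `maximalSub ∌ v₀` (Zorn, `Classical.choose`), and file 337 identified it
with `π_{χ_λ}` on the inert package. This file removes the choice: the same conclusions hold for EVERY `G`-stable
subspace `N ⊆ ⟨G v₀⟩` not containing `v₀`, and every irreducible quotient of `⟨G v₀⟩` missing `v₀` is `π_{χ_λ}`: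

* generic (`ρ` on `V`, `K` with finite orbits on `G / K`, `v₀ ≠ 0` a `K`-invariant all of whose `K`-invariant
  `G`-translates-combinations are multiples of it): **`invariants_quotientBySub_eq`** — the `K`-invariants of
  `⟨G v₀⟩ / N` are the line through `[v₀]`; `heckeSMul_quotientBySub_mk_gen`, **`heckeCharacter_quotientBySub`**
  — `T · v₀ = c • v₀` forces `χ_{⟨G v₀⟩ / N}(T) = c` when the quotient is irreducible;
  **`eq_top_of_mem_invariants_of_ne_zero`** — a `G`-stable subspace of `⟨G v₀⟩` containing a non-zero `K`-invariant
  vector is everything (so a subquotient `A / B` of `⟨G v₀⟩` with non-zero `K`-invariants has `A = ⟨G v₀⟩`);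
* inert (`ρ = rightRegular`, `v₀ = sphericalVector (α q⁻²)`): **`nonempty_equiv_quotientBySub_quotRep`** — every
  irreducible quotient of `⟨G f₀⟩` by a `G`-stable subspace missing `f₀` is `≅ π_{χ_λ}`,
  `λ = q²(α + α⁻¹) + (q − 1)`; **`nonempty_equiv_quotientBySub_inertSphericalQuot`** — hence `≅` the chosen
  spherical subquotient of file 337: THE SPHERICAL SUBQUOTIENT OF `I(α q⁻²)` IS WELL DEFINED UP TO ISOMORPHISM.

Nothing here is a statement about (P), theta lifts or L-values. §8(d): uses an L-value-free non-vanishing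
device: NO.
-/

open Summit.Ventures.HodgeRepro2.T5HeckeBasisCells Summit.Ventures.HodgeRepro2.T5HeckePermutationModule
  Summit.Ventures.HodgeRepro2.LevelPositivity Summit.Ventures.HodgeRepro2.T5UnitaryGroupForm
  Summit.Ventures.HodgeRepro2.T5HermitianThreeElements Summit.Ventures.HodgeRepro2.T5UnitaryHeckeAdjoint
  Summit.Ventures.HodgeRepro2.T5InertUnipotentResidue Summit.Ventures.HodgeRepro2.T5InertSatakeTransform
  Summit.Ventures.HodgeRepro2.T5InertPrincipalSeries Summit.Ventures.HodgeRepro2.T5InertIwasawa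
  Summit.Ventures.HodgeRepro2.T5HeckeDoubleCoset Summit.Ventures.HodgeRepro2.T5InertUnipotentRadical
  Summit.Ventures.HodgeRepro2.T5InertIwasawaCosets Summit.Ventures.HodgeRepro2.T5InertSphericalClassification
  Summit.Ventures.HodgeRepro2.T5InertSphericalVector Summit.Ventures.HodgeRepro2.T5CyclicSubquotient
  Summit.Ventures.HodgeRepro2.T5LevelIdempotent Summit.Ventures.HodgeRepro2.T5HeckeCommutativeMultiplicityOne
  Summit.Ventures.HodgeRepro2.T5HeckeInducedIrreducible Summit.Ventures.HodgeRepro2.T5HeckeCharacterRepresentation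
  Summit.Ventures.HodgeRepro2.T5InertHeckeCharacter Summit.Ventures.HodgeRepro2.T5LevelIdempotentNaturality
  Summit.Ventures.HodgeRepro2.T5InertSphericalSubquotient

namespace Summit.Ventures.HodgeRepro2.T5CyclicSubquotientUnique

section Generic

variable {G : Type*} [Group G] {k : Type*} [Field k] {V : Type*} [AddCommGroup V] [Module k V]
  (ρ : Representation k G V) {K : Subgroup G} (v₀ : V) (hv₀ : v₀ ∈ invariants ρ K)
  (N : Submodule k (cyclicSpan ρ v₀ hv₀))
  (hN : ∀ (g : G) ⦃w : cyclicSpan ρ v₀ hv₀⦄, w ∈ N → cyclicRep ρ v₀ hv₀ g w ∈ N)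

/-- The image of the generator is `K`-invariant in any quotient of `⟨G v₀⟩` by a `G`-stable subspace. -/
theorem mk_gen_mem_invariants_quotientBySub :
    (Submodule.Quotient.mk (gen ρ v₀ hv₀) : cyclicSpan ρ v₀ hv₀ ⧸ N) ∈
      invariants (quotientBySub (cyclicRep ρ v₀ hv₀) N hN) K := by
  rw [mem_invariants_iff]
  intro κ hκ
  rw [quotientRep_mk]
  congr 1
  exact (mem_invariants_iff.1 (gen_mem_invariants ρ v₀ hv₀)) κ hκ

/-- `[v₀] ≠ 0` in `⟨G v₀⟩ / N` when `v₀ ∉ N`. -/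
theorem mk_gen_ne_zero_of_notMem (hgen : gen ρ v₀ hv₀ ∉ N) :
    (Submodule.Quotient.mk (gen ρ v₀ hv₀) : cyclicSpan ρ v₀ hv₀ ⧸ N) ≠ 0 :=
  fun h => hgen ((Submodule.Quotient.mk_eq_zero _).1 h)

/-- The `K`-invariants of `⟨G v₀⟩ / N` are non-zero when `v₀ ∉ N`. -/
theorem invariants_quotientBySub_ne_bot (hgen : gen ρ v₀ hv₀ ∉ N) :
    invariants (quotientBySub (cyclicRep ρ v₀ hv₀) N hN) K ≠ ⊥ :=
  fun h => mk_gen_ne_zero_of_notMem ρ v₀ hv₀ N hgen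
    ((Submodule.mem_bot k).1 (h ▸ mk_gen_mem_invariants_quotientBySub ρ v₀ hv₀ N hN))

/-- **`T · v₀ = c • v₀` descends to `[v₀]` in every quotient `⟨G v₀⟩ / N`** (p8's `invariantsMap_heckeSMul`
through the projection). -/
theorem heckeSMul_quotientBySub_mk_gen (T : heckeAlgebra k K) {c : k}
    (hT : heckeSMul ρ T ⟨v₀, hv₀⟩ = c • ⟨v₀, hv₀⟩) :
    heckeSMul (quotientBySub (cyclicRep ρ v₀ hv₀) N hN) T
        ⟨Submodule.Quotient.mk (gen ρ v₀ hv₀), mk_gen_mem_invariants_quotientBySub ρ v₀ hv₀ N hN⟩ =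
      c • ⟨Submodule.Quotient.mk (gen ρ v₀ hv₀), mk_gen_mem_invariants_quotientBySub ρ v₀ hv₀ N hN⟩ := by
  have hq := mkQ_equivariant (cyclicRep ρ v₀ hv₀) N hN
  have e : invariantsMap (σ := quotientBySub (cyclicRep ρ v₀ hv₀) N hN) N.mkQ hq K
      ⟨gen ρ v₀ hv₀, gen_mem_invariants ρ v₀ hv₀⟩ =
        ⟨Submodule.Quotient.mk (gen ρ v₀ hv₀), mk_gen_mem_invariants_quotientBySub ρ v₀ hv₀ N hN⟩ :=
    Subtype.ext (by rw [invariantsMap_apply, Submodule.mkQ_apply])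
  rw [← e, ← invariantsMap_heckeSMul, heckeSMul_cyclicRep_gen ρ v₀ hv₀ T hT, map_smul]

/-- The class of `[v₀]` in the `K`-invariants of `⟨G v₀⟩ / N` is non-zero when `v₀ ∉ N`. -/
theorem mk_gen_invariants_quotientBySub_ne_zero (hgen : gen ρ v₀ hv₀ ∉ N) :
    (⟨Submodule.Quotient.mk (gen ρ v₀ hv₀), mk_gen_mem_invariants_quotientBySub ρ v₀ hv₀ N hN⟩ :
      invariants (quotientBySub (cyclicRep ρ v₀ hv₀) N hN) K) ≠ 0 :=
  fun h => mk_gen_ne_zero_of_notMem ρ v₀ hv₀ N hgen (congrArg Subtype.val h)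

include hN in
/-- **A `G`-stable subspace of `⟨G v₀⟩` containing a non-zero `K`-invariant vector is everything**, when every
`K`-invariant of `⟨G v₀⟩` is a multiple of `v₀` (so a subquotient `A / B` of `⟨G v₀⟩` with non-zero
`K`-invariants has `A = ⟨G v₀⟩`). -/
theorem eq_top_of_mem_invariants_of_ne_zero
    (hC : ∀ w ∈ cyclicSpan ρ v₀ hv₀, w ∈ invariants ρ K → ∃ a : k, w = a • v₀)
    {w : cyclicSpan ρ v₀ hv₀} (hwN : w ∈ N) (hwK : w ∈ invariants (cyclicRep ρ v₀ hv₀) K) (hw0 : w ≠ 0) :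
    N = ⊤ := by
  have hwK' : (w : V) ∈ invariants ρ K := by
    rw [mem_invariants_iff] at hwK ⊢
    intro κ hκ
    rw [← coe_cyclicRep_apply, hwK κ hκ]
  obtain ⟨a, ha⟩ := hC _ w.2 hwK'
  have hw : w = a • gen ρ v₀ hv₀ := Subtype.ext ha
  have ha0 : a ≠ 0 := by
    rintro rfl
    exact hw0 (by rw [hw, zero_smul])
  refine eq_top_of_gen_mem ρ v₀ hv₀ hN ?_
  have : gen ρ v₀ hv₀ = a⁻¹ • w := by rw [hw, smul_smul, inv_mul_cancel₀ ha0, one_smul]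
  rw [this]
  exact N.smul_mem _ hwN

variable [CharZero k]

/-- **The `K`-invariants of `⟨G v₀⟩ / N` are the line through `[v₀]`** for every `G`-stable `N`, when every
`K`-invariant of `⟨G v₀⟩` is a multiple of `v₀` (file 336's argument with `N` in place of `maximalSub`). -/
theorem invariants_quotientBySub_eq (hfin : ∀ g : G, Finite (MulAction.orbit K (g : G ⧸ K)))
    (hC : ∀ w ∈ cyclicSpan ρ v₀ hv₀, w ∈ invariants ρ K → ∃ a : k, w = a • v₀) :
    invariants (quotientBySub (cyclicRep ρ v₀ hv₀) N hN) K =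
      k ∙ (Submodule.Quotient.mk (gen ρ v₀ hv₀) : cyclicSpan ρ v₀ hv₀ ⧸ N) := by
  apply le_antisymm
  · intro x hx
    obtain ⟨w, rfl⟩ := Submodule.Quotient.mk_surjective _ x
    have hK := kFinite_cyclicRep ρ v₀ hv₀ hfin
    haveI := hK w
    have h1 : levelAverage (quotientBySub (cyclicRep ρ v₀ hv₀) N hN) K (Submodule.Quotient.mk w) =
        Submodule.Quotient.mk w := levelAverage_of_mem_invariants hx
    have h2 := map_levelAverage' (σ := quotientBySub (cyclicRep ρ v₀ hv₀) N hN) (f := N.mkQ)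
      (mkQ_equivariant (cyclicRep ρ v₀ hv₀) N hN) hK w
    have h3 : levelAverage (cyclicRep ρ v₀ hv₀) K w ∈ invariants (cyclicRep ρ v₀ hv₀) K :=
      levelAverage_mem_invariants
    have h4 : ((levelAverage (cyclicRep ρ v₀ hv₀) K w : cyclicSpan ρ v₀ hv₀) : V) ∈ invariants ρ K := by
      rw [mem_invariants_iff] at h3 ⊢
      intro κ hκ
      rw [← coe_cyclicRep_apply, h3 κ hκ]
    obtain ⟨a, ha⟩ := hC _ (levelAverage (cyclicRep ρ v₀ hv₀) K w).2 h4
    have h5 : levelAverage (cyclicRep ρ v₀ hv₀) K w = a • gen ρ v₀ hv₀ := Subtype.ext ha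
    rw [Submodule.mem_span_singleton]
    refine ⟨a, ?_⟩
    calc a • (Submodule.Quotient.mk (gen ρ v₀ hv₀) : cyclicSpan ρ v₀ hv₀ ⧸ N)
        = N.mkQ (a • gen ρ v₀ hv₀) := by rw [map_smul, Submodule.mkQ_apply]
      _ = N.mkQ (levelAverage (cyclicRep ρ v₀ hv₀) K w) := by rw [h5]
      _ = levelAverage (quotientBySub (cyclicRep ρ v₀ hv₀) N hN) K (N.mkQ w) := h2
      _ = Submodule.Quotient.mk w := by rw [Submodule.mkQ_apply, h1]
  · rw [Submodule.span_le, Set.singleton_subset_iff]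
    exact mk_gen_mem_invariants_quotientBySub ρ v₀ hv₀ N hN

/-- The `K`-invariants of `⟨G v₀⟩ / N` are finite-dimensional. -/
theorem finiteDimensional_invariants_quotientBySub (hfin : ∀ g : G, Finite (MulAction.orbit K (g : G ⧸ K)))
    (hC : ∀ w ∈ cyclicSpan ρ v₀ hv₀, w ∈ invariants ρ K → ∃ a : k, w = a • v₀) :
    FiniteDimensional k (invariants (quotientBySub (cyclicRep ρ v₀ hv₀) N hN) K) := by
  rw [invariants_quotientBySub_eq ρ v₀ hv₀ N hN hfin hC]
  infer_instance

/-- **THE HECKE CHARACTER OF EVERY IRREDUCIBLE QUOTIENT OF `⟨G v₀⟩` MISSING `v₀` IS READ OFF `v₀`**: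
`T · v₀ = c • v₀` in `V` forces `χ_{⟨G v₀⟩ / N}(T) = c`. -/
theorem heckeCharacter_quotientBySub [IsAlgClosed k] (hfin : ∀ g : G, Finite (MulAction.orbit K (g : G ⧸ K)))
    (hC : ∀ w ∈ cyclicSpan ρ v₀ hv₀, w ∈ invariants ρ K → ∃ a : k, w = a • v₀)
    (hgen : gen ρ v₀ hv₀ ∉ N) [(quotientBySub (cyclicRep ρ v₀ hv₀) N hN).IsIrreducible]
    (hcomm : ∀ T S : heckeAlgebra k K, T * S = S * T) (T : heckeAlgebra k K) {c : k}
    (hT : heckeSMul ρ T ⟨v₀, hv₀⟩ = c • ⟨v₀, hv₀⟩) :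
    haveI := finiteDimensional_invariants_quotientBySub ρ v₀ hv₀ N hN hfin hC
    heckeCharacter (quotientBySub (cyclicRep ρ v₀ hv₀) N hN)
      (kFinite_quotientRep (cyclicRep ρ v₀ hv₀) (kFinite_cyclicRep ρ v₀ hv₀ hfin) N hN) hfin
      (invariants_quotientBySub_ne_bot ρ v₀ hv₀ N hN hgen) hcomm T = c := by
  haveI := finiteDimensional_invariants_quotientBySub ρ v₀ hv₀ N hN hfin hC
  exact heckeCharacter_eq_of_smul_eq _ _ _ _ _ (mk_gen_invariants_quotientBySub_ne_zero ρ v₀ hv₀ N hN hgen)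
    (heckeSMul_quotientBySub_mk_gen ρ v₀ hv₀ N hN T hT)

end Generic

section Inert

variable {R E : Type*} [CommRing R] [Field E] [StarRing E] [Algebra R E] [IsFractionRing R E] [IsDomain R]
  [IsDiscreteValuationRing R] [Finite (IsLocalRing.ResidueField R)]
  (hstar : ∀ x : E, IsLocalization.IsInteger R x → IsLocalization.IsInteger R (star x))
  (u : E) (hsu : star u = u) (hu0 : u ≠ 0) (hu : IsLocalization.IsInteger R u)
  (hu' : IsLocalization.IsInteger R u⁻¹) {ϖ : R} (hϖ : Irreducible ϖ)
  (hs : star (algebraMap R E ϖ) = algebraMap R E ϖ) (k : Type*) [Field k] [CharZero k] [IsAlgClosed k]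
  (he : ∃ e : R, algebraMap R E e + star (algebraMap R E e) = 1)
  (hnt : ∃ t, T5InertResidueInvolution.residueStar hstar hϖ hs t ≠ t) {α : k} (hα : α ≠ 0)
  (N : Submodule k (cyclicSpan (rightRegular k)
    (sphericalVector hstar u hsu hu0 hu hu' hϖ hs k (α * ((Nat.card (traceZero R E) : k) ^ 2)⁻¹))
    (sphericalVector_mem_invariants hstar u hsu hu0 hu hu' hϖ hs k _)))
  (hN : ∀ (g : formUnitaryGroup (J3 u)) ⦃w⦄, w ∈ N →
    cyclicRep (rightRegular k)
      (sphericalVector hstar u hsu hu0 hu hu' hϖ hs k (α * ((Nat.card (traceZero R E) : k) ^ 2)⁻¹))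
      (sphericalVector_mem_invariants hstar u hsu hu0 hu hu' hϖ hs k _) g w ∈ N)
  (hgen : gen (rightRegular k)
    (sphericalVector hstar u hsu hu0 hu hu' hϖ hs k (α * ((Nat.card (traceZero R E) : k) ^ 2)⁻¹))
    (sphericalVector_mem_invariants hstar u hsu hu0 hu hu' hϖ hs k _) ∉ N)
  [hirr : (quotientBySub (cyclicRep (rightRegular k)
    (sphericalVector hstar u hsu hu0 hu hu' hϖ hs k (α * ((Nat.card (traceZero R E) : k) ^ 2)⁻¹))
    (sphericalVector_mem_invariants hstar u hsu hu0 hu hu' hϖ hs k _)) N hN).IsIrreducible]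

include he hnt hα hgen in
/-- **EVERY IRREDUCIBLE QUOTIENT OF `⟨G f₀⟩ ⊆ I(α q⁻²)` MISSING `f₀` IS `π_{χ_λ}`**, `λ = q²(α + α⁻¹) + (q − 1)`,
for every character `χ` with `χ(T₁) = λ`. -/
theorem nonempty_equiv_quotientBySub_quotRep
    (χ : heckeAlgebra k (hyperspecialSubgroup R (J3 u)) →ₐ[k] k)
    (hχ : χ (heckeBasisCells hstar u hsu hu0 hu hu' hϖ hs k 1) =
      (Nat.card (traceZero R E) : k) ^ 2 * (α + α⁻¹) + ((Nat.card (traceZero R E) : k) - 1)) :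
    letI := charModule k (hyperspecialSubgroup R (J3 u)) χ
    letI := charScalarTower k (hyperspecialSubgroup R (J3 u)) χ
    haveI := isIrreducible_quotRep_char k (hyperspecialSubgroup R (J3 u)) (fun _ => inferInstance) χ
    haveI := finiteDimensional_invariants_quotRep_char k (hyperspecialSubgroup R (J3 u))
      (fun _ => inferInstance) χ
    haveI := finiteDimensional_invariants_quotientBySub (rightRegular k) _ _ N hN (fun _ => inferInstance)
      (exists_eq_smul_sphericalVector hstar u hsu hu0 hu hu' hϖ hs k
        (param_mul_inv_ne_zero (R := R) (E := E) k hα))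
    Nonempty ((quotientBySub (cyclicRep (rightRegular k)
      (sphericalVector hstar u hsu hu0 hu hu' hϖ hs k (α * ((Nat.card (traceZero R E) : k) ^ 2)⁻¹))
      (sphericalVector_mem_invariants hstar u hsu hu0 hu hu' hϖ hs k _)) N hN).Equiv
        (quotRep k (hyperspecialSubgroup R (J3 u)) k (fun _ => inferInstance))) := by
  letI := charModule k (hyperspecialSubgroup R (J3 u)) χ
  letI := charScalarTower k (hyperspecialSubgroup R (J3 u)) χ
  haveI := isIrreducible_quotRep_char k (hyperspecialSubgroup R (J3 u)) (fun _ => inferInstance) χ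
  haveI := finiteDimensional_invariants_quotRep_char k (hyperspecialSubgroup R (J3 u))
    (fun _ => inferInstance) χ
  have hC := exists_eq_smul_sphericalVector hstar u hsu hu0 hu hu' hϖ hs k
    (param_mul_inv_ne_zero (R := R) (E := E) k hα)
  haveI := finiteDimensional_invariants_quotientBySub (rightRegular k) _ _ N hN (fun _ => inferInstance) hC
  exact (nonempty_equiv_quotRep_char_iff hstar u hsu hu0 hu hu' hϖ hs k _ χ hχ _
    (kFinite_quotientRep _ (kFinite_cyclicRep _ _ _ (fun _ => inferInstance)) N hN)
    (invariants_quotientBySub_ne_bot _ _ _ N hN hgen)).2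
    (heckeCharacter_quotientBySub (rightRegular k) _ _ N hN (fun _ => inferInstance) hC hgen
      (mul_comm' hstar u hsu hu0 hu hu' hϖ hs k) _
      (heckeSMul_heckeBasisCells_one_sphericalVector hstar u hsu hu0 hu hu' hϖ hs k he hnt hα))

include he hnt hα hgen in
/-- **THE SPHERICAL SUBQUOTIENT OF `I(α q⁻²)` IS WELL DEFINED UP TO ISOMORPHISM**: every irreducible quotient of
`⟨G f₀⟩` by a `G`-stable subspace missing `f₀` is isomorphic to file 337's `inertSphericalQuot (α q⁻²)` (both are
`π_{χ_λ}`; the character `χ` with `χ(T₁) = λ` exists by file 334's `exists_algHom_apply_one_eq`). -/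
theorem nonempty_equiv_quotientBySub_inertSphericalQuot :
    Nonempty ((quotientBySub (cyclicRep (rightRegular k)
      (sphericalVector hstar u hsu hu0 hu hu' hϖ hs k (α * ((Nat.card (traceZero R E) : k) ^ 2)⁻¹))
      (sphericalVector_mem_invariants hstar u hsu hu0 hu hu' hϖ hs k _)) N hN).Equiv
        (inertSphericalQuot hstar u hsu hu0 hu hu' hϖ hs k (α * ((Nat.card (traceZero R E) : k) ^ 2)⁻¹))) := by
  obtain ⟨χ, hχ⟩ := exists_algHom_apply_one_eq hstar u hsu hu0 hu hu' hϖ hs k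
    ((Nat.card (traceZero R E) : k) ^ 2 * (α + α⁻¹) + ((Nat.card (traceZero R E) : k) - 1))
  letI := charModule k (hyperspecialSubgroup R (J3 u)) χ
  letI := charScalarTower k (hyperspecialSubgroup R (J3 u)) χ
  haveI := isIrreducible_quotRep_char k (hyperspecialSubgroup R (J3 u)) (fun _ => inferInstance) χ
  haveI := finiteDimensional_invariants_quotRep_char k (hyperspecialSubgroup R (J3 u))
    (fun _ => inferInstance) χ
  obtain ⟨e₁⟩ := nonempty_equiv_quotientBySub_quotRep hstar u hsu hu0 hu hu' hϖ hs k he hnt hα N hN hgen χ hχ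
  obtain ⟨e₂⟩ := nonempty_equiv_inertSphericalQuot_quotRep hstar u hsu hu0 hu hu' hϖ hs k he hnt hα χ hχ
  exact ⟨e₁.trans e₂.symm⟩

end Inert

end Summit.Ventures.HodgeRepro2.T5CyclicSubquotientUnique
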